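import Literature.NumberTheory.Automorphic.IdeleClassGroupAutomorphicQuotientProofs
import Mathlib.Topology.Algebra.Group.Matrix
import Mathlib.Topology.Algebra.ProperAction.Basic
import HarnessLib

/-!
# `GL_n(K)` is discrete in `GL_n(𝔸_K)`, `A_G · GL_n(K)` is closed, the automorphic quotient is Hausdorff
(Borel, *Some finiteness properties of adele groups over number fields*, Publ. Math. IHÉS 16
(1963), §5; Weil, *Basic Number Theory* (1967), Ch. IV §2 Thm. 2, §4 Thm. 5–6; Cassels–Fröhlich,
Ch. II §14 and §16)

Sibling proof file of `AdelicGroupData`, discharging three of its named facts about the honest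
datum `AdelicGroupData.gl n K` (`Adelic = GL_n(𝔸_K)`, automorphic quotient
`GL_n(𝔸_K) ⧸ (A_G · GL_n(K))`, outline D10):

* `gl_isDiscreteRational_holds n K` — **`GL_n(K)` is a discrete subgroup of `GL_n(𝔸_K)`**
  (`gl_isDiscreteRational`): the principal adeles are discrete in `𝔸_K`
  (`AdeleRing.exists_isOpen_forall_algebraMap_mem_eq_zero` of `AdeleRingTopology`: an open `U ∋ 0`
  with `U ∩ K = {0}`), and `{g : (g - 1)ᵢⱼ ∈ U for all i, j}` is an open neighbourhood of `1` in
  `GL_n(𝔸_K)` meeting `GL_n(K)` in `{1}`.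
* `isClosed_quotientSubgroup_gl_holds n K` — **`A_G · GL_n(K)` is closed in `GL_n(𝔸_K)`**
  (`isClosed_quotientSubgroup_gl`). Proof: let `θ : GL_n(𝔸_K) →* A_G` be the continuous
  retraction `g ↦ z(|det g|_𝔸^{1/(n[K:ℚ])})` (idelic norm `IdeleClassGroup.ideleNorm`, positive
  real scalars `posRealScalar`; `|det z(r)|_𝔸 = r^{n[K:ℚ]}`, and `|det γ|_𝔸 = 1` on `GL_n(K)` by
  the product formula `ideleNorm_principal`). Then `A_G · GL_n(K) = {g : θ(g)⁻¹ g ∈ GL_n(K)}`,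
  the preimage of the discrete — hence closed — subgroup `GL_n(K)` under a continuous map. This
  is Weil's splitting `k_𝔸ˣ = k_𝔸¹ × M` (BNT IV §4, Cor. 2 of Thm. 5) composed with `det`.
* `t2Space_automorphicQuotient_gl_holds n K` — **the automorphic quotient
  `GL_n(𝔸_K) ⧸ (A_G · GL_n(K))` is Hausdorff** (`t2Space_automorphicQuotient_gl`): Mathlib's
  `QuotientGroup.instT2Space` for the quotient of a topological group by a closed subgroup
  (proper action of a closed subgroup).

Also proved on the way: `t2Space_gl` (`GL_n(𝔸_K)` is Hausdorff), `ideleNorm_det_toAdelic`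
(`|det γ|_𝔸 = 1`), `ideleNormUnits_det_posRealScalar` (`|det z(r)|_𝔸 = r^{n[K:ℚ]}`),
`center'_inf_arithmeticSubgroup_gl` (`A_G ∩ GL_n(K) = 1`), `exists_centralRetraction_gl` (the
retraction `θ`), `quotientSubgroup_gl_eq_preimage` and `isClosed_arithmeticSubgroup_gl`.

These are the point-set inputs of every unfolding / kernel computation on
`L²(GL_n(𝔸_K) ⧸ A_G GL_n(K))` (fifth layer of the `provefact` decomposition of
`AutomorphicGLn.isDiscretelyDecomposable_cuspidal`: Getz–Hahn (2024), Lemma 9.2.4, needs `G(F)`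
discrete; measurability of compact pieces of the quotient needs Hausdorffness).

## References

* A. Borel, *Some finiteness properties of adele groups over number fields*, Publ. Math. IHÉS 16
  (1963), §5 [Borel1963].
* A. Weil, *Basic Number Theory* (1967), Ch. IV §2 Thm. 2 (`k` discrete in `k_𝔸`), §4 Thm. 5 and
  its Cor. 2 (`z → |z|_𝔸`, `k_𝔸ˣ = k_𝔸¹ × M`) [WeilBNT1967].
* J. W. S. Cassels, A. Fröhlich (eds.), *Algebraic Number Theory* (1967), Ch. II §14 Theorem, §16
  [CasselsFrohlichANT1967].
-/

noncomputable section

open scoped MatrixGroups NNReal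
open NumberField IsDedekindDomain Topology

namespace Literature.NumberTheory.Automorphic

/-! ### A subgroup missing an open neighbourhood of `1` is discrete -/

section General

variable {G : Type*} [Group G] [TopologicalSpace G]

/-- A subgroup `S` of a topological group is **discrete** as soon as some open neighbourhood `U`
of `1` contains no element of `S` other than `1` (multiplicative twin of
`AddSubgroup.discreteTopology_of_isOpen_forall_eq_zero` of `AdeleRingTopology`). [folklore] -/
theorem Subgroup.discreteTopology_of_isOpen_forall_eq_one [IsTopologicalGroup G]
    (S : Subgroup G) {U : Set G} (hU : IsOpen U) (h1 : (1 : G) ∈ U)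
    (h : ∀ x ∈ S, x ∈ U → x = 1) : DiscreteTopology S := by
  refine discreteTopology_of_isOpen_singleton_one ?_
  have : ({1} : Set S) = Subtype.val ⁻¹' U := by
    ext ⟨x, hx⟩
    simp only [Set.mem_singleton_iff, Set.mem_preimage]
    constructor
    · intro hx1
      have : x = 1 := congrArg Subtype.val hx1
      rw [this]
      exact h1
    · intro hxU
      exact Subtype.ext (h x hx hxU)
  rw [this]
  exact hU.preimage continuous_subtype_val

end General

section GLn

variable (n : ℕ) (K : Type) [Field K] [NumberField K]

/-! ### `GL_n(𝔸_K)` is Hausdorff -/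

/-- `GL_n(𝔸_K)` is Hausdorff: units of the Hausdorff topological ring `M_n(𝔸_K)`,
`𝔸_K = K_∞ × 𝔸_K^∞` a product of Hausdorff rings (Platonov–Rapinchuk §5.1; the same three
`inferInstanceAs` as in `GLnAdelicLocallyCompact`). [folklore] -/
theorem t2Space_gl : T2Space (GL (Fin n) (AdeleRing (𝓞 K) K)) := by
  haveI : T2Space (FiniteAdeleRing (𝓞 K) K) := inferInstanceAs <| T2Space
    (RestrictedProduct (fun v : HeightOneSpectrum (𝓞 K) => v.adicCompletion K)
      (fun v => (v.adicCompletionIntegers K : Set (v.adicCompletion K))) Filter.cofinite)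
  haveI : T2Space (InfiniteAdeleRing K) :=
    inferInstanceAs <| T2Space ((w : InfinitePlace K) → w.Completion)
  haveI : T2Space (AdeleRing (𝓞 K) K) :=
    inferInstanceAs <| T2Space (InfiniteAdeleRing K × FiniteAdeleRing (𝓞 K) K)
  infer_instance

/-! ### `GL_n(K)` is discrete in `GL_n(𝔸_K)` -/

/-- **`GL_n(K)` is a discrete subgroup of `GL_n(𝔸_K)`** (discharge of `gl_isDiscreteRational`):
with `U ∋ 0` open in `𝔸_K` and `U ∩ K = {0}` (`AdeleRing.exists_isOpen_forall_algebraMap_mem_eq_zero`,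
Cassels–Fröhlich II §14), the set `{g : (g - 1)ᵢⱼ ∈ U ∀ i j}` is an open neighbourhood of `1` in
`GL_n(𝔸_K)` (entries are continuous) whose only rational point is `1` (each entry of `γ - 1` is
a principal adele in `U`). Borel (1963), §5; Platonov–Rapinchuk Ch. 5. [cite: Borel1963, §5] -/
theorem gl_isDiscreteRational_holds : AdelicGroupData.gl_isDiscreteRational n K := by
  obtain ⟨U, hU, hU0, hUK⟩ := AdeleRing.exists_isOpen_forall_algebraMap_mem_eq_zero K
  change DiscreteTopology ↥(AdelicGroupData.gl n K).arithmeticSubgroup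
  set V : Set (GL (Fin n) (AdeleRing (𝓞 K) K)) :=
    {g | ∀ i j : Fin n, (g : Matrix (Fin n) (Fin n) (AdeleRing (𝓞 K) K)) i j -
      (1 : Matrix (Fin n) (Fin n) (AdeleRing (𝓞 K) K)) i j ∈ U} with hV
  have hVo : IsOpen V := by
    rw [hV, show {g : GL (Fin n) (AdeleRing (𝓞 K) K) | ∀ i j : Fin n,
        (g : Matrix (Fin n) (Fin n) (AdeleRing (𝓞 K) K)) i j -
          (1 : Matrix (Fin n) (Fin n) (AdeleRing (𝓞 K) K)) i j ∈ U} =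
        ⋂ i : Fin n, ⋂ j : Fin n, (fun g : GL (Fin n) (AdeleRing (𝓞 K) K) =>
          (g : Matrix (Fin n) (Fin n) (AdeleRing (𝓞 K) K)) i j -
            (1 : Matrix (Fin n) (Fin n) (AdeleRing (𝓞 K) K)) i j) ⁻¹' U by
      ext g; simp only [Set.mem_setOf_eq, Set.mem_iInter, Set.mem_preimage]]
    refine isOpen_iInter_of_finite fun i => isOpen_iInter_of_finite fun j => hU.preimage ?_
    exact (Units.continuous_val.matrix_elem i j).sub continuous_const
  have hV1 : (1 : GL (Fin n) (AdeleRing (𝓞 K) K)) ∈ V := by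
    intro i j
    rw [Units.val_one, sub_self]
    exact hU0
  refine Subgroup.discreteTopology_of_isOpen_forall_eq_one _ hVo hV1 ?_
  rintro _ ⟨γ, rfl⟩ hγ
  change GL (Fin n) K at γ
  -- every entry of `γ - 1` is a principal adele in `U`, hence `γ = 1`
  have hγ1 : γ = 1 := by
    refine Matrix.GeneralLinearGroup.ext fun i j => ?_
    have h := hγ i j
    change (Matrix.GeneralLinearGroup.map (algebraMap K (AdeleRing (𝓞 K) K)) γ :
        Matrix (Fin n) (Fin n) (AdeleRing (𝓞 K) K)) i j - _ ∈ U at h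
    rw [Matrix.GeneralLinearGroup.map_apply] at h
    have h1 : (1 : Matrix (Fin n) (Fin n) (AdeleRing (𝓞 K) K)) i j =
        algebraMap K (AdeleRing (𝓞 K) K) ((1 : Matrix (Fin n) (Fin n) K) i j) := by
      rw [Matrix.one_apply, Matrix.one_apply]
      split_ifs
      · rw [map_one]
      · rw [map_zero]
    rw [h1, ← map_sub] at h
    have h2 : (γ : Matrix (Fin n) (Fin n) K) i j - (1 : Matrix (Fin n) (Fin n) K) i j = 0 := hUK _ h
    show (γ : Matrix (Fin n) (Fin n) K) i j = ((1 : GL (Fin n) K) : Matrix (Fin n) (Fin n) K) i j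
    rw [Units.val_one]
    exact sub_eq_zero.1 h2
  change Matrix.GeneralLinearGroup.map (algebraMap K (AdeleRing (𝓞 K) K)) γ = 1
  rw [hγ1, map_one]

/-- The arithmetic subgroup `GL_n(K)` is closed in `GL_n(𝔸_K)` (discrete subgroups of Hausdorff
groups are closed, Mathlib `Subgroup.isClosed_of_discrete`). [folklore] -/
theorem isClosed_arithmeticSubgroup_gl :
    IsClosed ((AdelicGroupData.gl n K).arithmeticSubgroup : Set (AdelicGroupData.gl n K).Adelic) := by
  haveI : T2Space (AdelicGroupData.gl n K).Adelic := t2Space_gl n K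
  haveI : DiscreteTopology ↥(AdelicGroupData.gl n K).arithmeticSubgroup :=
    gl_isDiscreteRational_holds n K
  exact Subgroup.isClosed_of_discrete

/-! ### The idelic norm of the determinant -/

/-- **Product formula for `det`**: `|det γ|_𝔸 = 1` for `γ ∈ GL_n(K)` (`det γ` is a principal
idele; `ideleNorm_principal`, Cassels–Fröhlich II §12; Weil IV §4 Thm. 5). [folklore] -/
theorem ideleNorm_det_toAdelic (γ : GL (Fin n) K) :
    IdeleClassGroup.ideleNorm K
        (Matrix.GeneralLinearGroup.det ((AdelicGroupData.gl n K).toAdelic γ)) = 1 := by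
  refine ideleNorm_principal ?_
  change Matrix.GeneralLinearGroup.det
      (Matrix.GeneralLinearGroup.map (algebraMap K (AdeleRing (𝓞 K) K)) γ) ∈ _
  rw [Matrix.GeneralLinearGroup.map_det]
  exact ⟨Matrix.GeneralLinearGroup.det γ, rfl⟩

/-- `det z(r) = ρ(r)ⁿ`: the determinant of the positive real scalar matrix `posRealScalar n K r`
is the `n`-th power of the positive real idele `posRealIdele K r`
(Mathlib `GeneralLinearGroup.det_scalar`). [folklore] -/
theorem det_posRealScalar (r : ℝ≥0ˣ) :
    Matrix.GeneralLinearGroup.det (posRealScalar n K r) = posRealIdele K r ^ n := by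
  change Matrix.GeneralLinearGroup.det
      (Matrix.GeneralLinearGroup.scalar (Fin n) (posRealIdele K r)) = _
  rw [Matrix.GeneralLinearGroup.det_scalar, Fintype.card_fin]

/-- `|det z(r)|_𝔸 = r^{n [K:ℚ]}` in `ℝ_{>0}` (`ideleNormUnits_posRealIdele`: `|ρ(r)|_𝔸 = r^{[K:ℚ]}`,
Weil IV §4, proof of Cor. 2 of Thm. 5). [cite: WeilBNT1967, Ch. IV §4 Cor. 2 of Thm. 5] -/
theorem ideleNormUnits_det_posRealScalar (r : ℝ≥0ˣ) :
    ideleNormUnits K (Matrix.GeneralLinearGroup.det (posRealScalar n K r)) =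
      r ^ (n * Module.finrank ℚ K) := by
  rw [det_posRealScalar, map_pow, IdeleClassGroup.ideleNormUnits_posRealIdele, ← pow_mul,
    mul_comm]

/-- **`A_G ∩ GL_n(K) = 1`**: a positive real scalar matrix which is rational is the identity
(`|det|_𝔸` is `r^{n[K:ℚ]}` on the one and `1` on the other; for `n = 0` the group is trivial).
Borel (1963), §5. [cite: Borel1963, §5] -/
theorem center'_inf_arithmeticSubgroup_gl :
    (AdelicGroupData.gl n K).center' ⊓ (AdelicGroupData.gl n K).arithmeticSubgroup = ⊥ := by
  rw [eq_bot_iff]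
  rintro g ⟨⟨r, rfl⟩, ⟨γ, hγ⟩⟩
  rw [Subgroup.mem_bot]
  rcases Nat.eq_zero_or_pos n with hn | hn
  · subst hn
    exact Subsingleton.elim (α := GL (Fin 0) (AdeleRing (𝓞 K) K)) _ _
  · have h1 : ideleNormUnits K (Matrix.GeneralLinearGroup.det (posRealScalar n K r)) = 1 := by
      change (AdelicGroupData.gl n K).toAdelic γ = posRealScalar n K r at hγ
      rw [← hγ]
      exact Units.ext (ideleNorm_det_toAdelic n K γ)
    rw [ideleNormUnits_det_posRealScalar] at h1
    have hr : r = 1 := by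
      have hne : n * Module.finrank ℚ K ≠ 0 := Nat.mul_ne_zero hn.ne' Module.finrank_pos.ne'
      have h2 : ((r : ℝ≥0) : ℝ) ^ (n * Module.finrank ℚ K) = 1 := by
        have := congrArg (fun u : ℝ≥0ˣ => ((u : ℝ≥0) : ℝ)) h1
        simpa using this
      have h3 : ((r : ℝ≥0) : ℝ) = 1 :=
        (pow_eq_one_iff_of_nonneg (NNReal.coe_nonneg _) hne).1 h2
      exact Units.ext (NNReal.coe_injective (by simpa using h3))
    change posRealScalar n K r = 1
    rw [hr, map_one]

/-! ### The central retraction and the closedness of `A_G · GL_n(K)` -/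

/-- **The central retraction `θ : GL_n(𝔸_K) →* A_G`**, `θ(g) = z(|det g|_𝔸^{1/(n[K:ℚ])})`: a
continuous homomorphism with values in `A_G`, the identity on `A_G`, trivial on `GL_n(K)` — the
`GL_n`-version (through `det`) of Weil's splitting `k_𝔸ˣ = k_𝔸¹ × M`, `M = z(ℝ_+ˣ)`
(BNT IV §4, Cor. 2 of Thm. 5; compare `IdeleClassGroup.exists_normOneRetraction` for `n = 1`).
For `n = 0` the trivial homomorphism serves. [cite: WeilBNT1967, Ch. IV §4 Cor. 2 of Thm. 5] -/
theorem exists_centralRetraction_gl :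
    ∃ θ : (AdelicGroupData.gl n K).Adelic →* (AdelicGroupData.gl n K).Adelic, Continuous θ ∧
      (∀ g, θ g ∈ (AdelicGroupData.gl n K).center') ∧
      (∀ a ∈ (AdelicGroupData.gl n K).center', θ a = a) ∧
      ∀ γ ∈ (AdelicGroupData.gl n K).arithmeticSubgroup, θ γ = 1 := by
  rcases Nat.eq_zero_or_pos n with hn | hn
  · subst hn
    refine ⟨1, continuous_const, fun g => ?_,
      fun a _ => Subsingleton.elim (α := GL (Fin 0) (AdeleRing (𝓞 K) K)) _ _,
      fun γ _ => Subsingleton.elim (α := GL (Fin 0) (AdeleRing (𝓞 K) K)) _ _⟩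
    rw [MonoidHom.one_apply]
    exact one_mem _
  · set N : ℕ := n * Module.finrank ℚ K with hN
    have hN0 : N ≠ 0 := Nat.mul_ne_zero hn.ne' Module.finrank_pos.ne'
    -- the `N`-th root on `ℝ_{>0}`
    let root : ℝ≥0ˣ →* ℝ≥0ˣ := Units.map (NNReal.rpowMonoidHom ((N : ℝ)⁻¹))
    have hroot : ∀ t : ℝ≥0ˣ, (root t : ℝ≥0) = (t : ℝ≥0) ^ ((N : ℝ)⁻¹) := fun t => rfl
    have hroot_pow' : ∀ t : ℝ≥0ˣ, root (t ^ N) = t := fun t =>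
      Units.ext (by rw [hroot, Units.val_pow_eq_pow_val, NNReal.pow_rpow_inv_natCast _ hN0])
    have hroot_cont : Continuous root :=
      Continuous.units_map _ (NNReal.continuous_rpow_const (by positivity))
    -- `θ = z ∘ root ∘ |·|_𝔸 ∘ det`
    let θ : (AdelicGroupData.gl n K).Adelic →* (AdelicGroupData.gl n K).Adelic :=
      (posRealScalar n K).comp (root.comp ((ideleNormUnits K).comp
        (Matrix.GeneralLinearGroup.det :
          GL (Fin n) (AdeleRing (𝓞 K) K) →* (AdeleRing (𝓞 K) K)ˣ)))
    have hθ : ∀ g, θ g = posRealScalar n K (root (ideleNormUnits K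
        (Matrix.GeneralLinearGroup.det g))) := fun g => rfl
    refine ⟨θ, ?_, fun g => ⟨_, (hθ g).symm⟩, ?_, ?_⟩
    · -- continuity of `r ↦ z(r)`: `Units.map` of the continuous `Matrix.scalar`, after `posRealIdele`
      have hscalar : Continuous (Matrix.scalar (Fin n) :
          AdeleRing (𝓞 K) K → Matrix (Fin n) (Fin n) (AdeleRing (𝓞 K) K)) := by
        have h : Continuous fun a : AdeleRing (𝓞 K) K => Matrix.diagonal fun _ : Fin n => a :=
          (continuous_pi fun _ => continuous_id).matrix_diagonal
        exact h.congr fun a => rfl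
      have hz : Continuous (posRealScalar n K) := by
        change Continuous fun r => Matrix.GeneralLinearGroup.scalar (Fin n) (posRealIdele K r)
        exact (Continuous.units_map (Matrix.scalar (Fin n)).toMonoidHom hscalar).comp
          (continuous_posRealIdele K)
      exact hz.comp (hroot_cont.comp ((continuous_ideleNormUnits K).comp
        Matrix.GeneralLinearGroup.continuous_det))
    · rintro _ ⟨r, rfl⟩
      change θ (posRealScalar n K r) = posRealScalar n K r
      rw [hθ, ideleNormUnits_det_posRealScalar, ← hN, hroot_pow']
    · rintro _ ⟨γ, rfl⟩
      rw [hθ]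
      have h1 : ideleNormUnits K (Matrix.GeneralLinearGroup.det
          ((AdelicGroupData.gl n K).toAdelic γ)) = 1 :=
        Units.ext (ideleNorm_det_toAdelic n K γ)
      rw [h1, map_one]
      exact map_one (posRealScalar n K)

/-- **`A_G · GL_n(K)` is the preimage of `GL_n(K)` under `g ↦ θ(g)⁻¹ g`** for any central
retraction `θ` as in `exists_centralRetraction_gl`: if `g = a γ` then `θ(g) = a` and
`θ(g)⁻¹ g = γ`; conversely `g = θ(g) · (θ(g)⁻¹ g)`. (The subgroup `quotientSubgroup = A_G ⊔ GL_n(K)`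
is the product set `A_G · GL_n(K)`, `A_G` being central.) [folklore] -/
theorem quotientSubgroup_gl_eq_preimage
    {θ : (AdelicGroupData.gl n K).Adelic →* (AdelicGroupData.gl n K).Adelic}
    (hθA : ∀ g, θ g ∈ (AdelicGroupData.gl n K).center')
    (hθa : ∀ a ∈ (AdelicGroupData.gl n K).center', θ a = a)
    (hθγ : ∀ γ ∈ (AdelicGroupData.gl n K).arithmeticSubgroup, θ γ = 1) :
    ((AdelicGroupData.gl n K).quotientSubgroup : Set (AdelicGroupData.gl n K).Adelic) =
      (fun g => (θ g)⁻¹ * g) ⁻¹' (AdelicGroupData.gl n K).arithmeticSubgroup := by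
  -- `A_G` is central, hence normal, so `A_G ⊔ Γ = A_G · Γ` as sets
  haveI : (AdelicGroupData.gl n K).center'.Normal :=
    ⟨fun a ha g => by
      rwa [Subgroup.mem_center_iff.1 ((AdelicGroupData.gl n K).center'_le ha) g,
        mul_inv_cancel_right]⟩
  change (((AdelicGroupData.gl n K).center' ⊔ (AdelicGroupData.gl n K).arithmeticSubgroup :
      Subgroup (AdelicGroupData.gl n K).Adelic) : Set (AdelicGroupData.gl n K).Adelic) = _
  rw [Subgroup.normal_mul]
  ext g
  simp only [Set.mem_preimage, SetLike.mem_coe]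
  constructor
  · rintro ⟨a, ha, γ, hγ, rfl⟩
    have : θ (a * γ) = a := by
      rw [map_mul, hθa a ha, hθγ γ hγ, mul_one]
    rwa [this, inv_mul_cancel_left]
  · intro hg
    exact ⟨θ g, hθA g, (θ g)⁻¹ * g, hg, mul_inv_cancel_left _ _⟩

/-- **`A_G · GL_n(K)` is closed in `GL_n(𝔸_K)`** (discharge of `isClosed_quotientSubgroup_gl`;
Borel (1963), §5): it is the preimage of the closed (discrete) subgroup `GL_n(K)` under the
continuous map `g ↦ θ(g)⁻¹ g` (`exists_centralRetraction_gl`, `quotientSubgroup_gl_eq_preimage`,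
`isClosed_arithmeticSubgroup_gl`). [cite: Borel1963, §5] -/
theorem isClosed_quotientSubgroup_gl_holds : AdelicGroupData.isClosed_quotientSubgroup_gl n K := by
  obtain ⟨θ, hθc, hθA, hθa, hθγ⟩ := exists_centralRetraction_gl n K
  change IsClosed ((AdelicGroupData.gl n K).quotientSubgroup : Set (AdelicGroupData.gl n K).Adelic)
  rw [quotientSubgroup_gl_eq_preimage n K hθA hθa hθγ]
  exact (isClosed_arithmeticSubgroup_gl n K).preimage ((hθc.inv).mul continuous_id)

/-! ### The automorphic quotient of `GL_n` is Hausdorff -/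

/-- **The automorphic quotient `GL_n(𝔸_K) ⧸ (A_G · GL_n(K))` is Hausdorff** (discharge of
`t2Space_automorphicQuotient_gl`; Borel (1963), §5): the quotient of a topological group by a
closed subgroup is `T₂` (Mathlib `QuotientGroup.instT2Space`, via the proper action of a closed
subgroup), and `A_G · GL_n(K)` is closed (`isClosed_quotientSubgroup_gl_holds`). [cite: Borel1963, §5] -/
theorem t2Space_automorphicQuotient_gl_holds : AdelicGroupData.t2Space_automorphicQuotient_gl n K := by
  haveI : IsClosed ((AdelicGroupData.gl n K).quotientSubgroup :
      Set (AdelicGroupData.gl n K).Adelic) := isClosed_quotientSubgroup_gl_holds n K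
  change T2Space ((AdelicGroupData.gl n K).Adelic ⧸ (AdelicGroupData.gl n K).quotientSubgroup)
  infer_instance

end GLn

end Literature.NumberTheory.Automorphic
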